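import Summits.Ventures.CertifiedManyBodySolver.Downfold.StiffnessSeam
import Summits.Ventures.CertifiedManyBodySolver.Observables.StiffnessApexTransportLaBoxE
import HarnessLib

/-!
# The La₂CuO₄ parent box at §OF-RECORD v1.15 (`boxLa214E_M13v115`, column M13, object E) and THE M2(b) STATEMENT DOMAIN
# `boxLa214E_M2b` («La214-E»: `t'/t ∈ [−3/10, −1/5] × U/t ∈ [29/5, 74/5] × n = 1 EXACTLY`), joined to the apex-transport leaves

Venture CertifiedManyBodySolver, cell `pub/hubbard-downfold` (MO-S1 ↔ S2 seam, D-0150 line L-DF2 «box ↦ one word»); namespace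
`Summit.Ventures.CertifiedManyBodySolver.Downfold`. Written by seat hubbard-downfold-unc-2 (`prover-hubbard-downfold-unc-2-g14-0`)
STANDING IN for the unseated modeller seat hubbard-downfold-mod-1 on the lead's outstanding ask «mod-1 types `boxLa214E_M13v115` on
re-seat; until then quantify over the literal rationals» (lead g11, STATUS 2026-08-27T22:57:53Z; carried by lead g12) — COLUMN M13 ONLY
(the other v1.15 re-issues stay mod-1's), in mod-1's own idiom (`BoxesLa214V110.lean`: `Box.withEntry` re-issues + accessor equations +
`Refines` transfers).

SOURCE OF THE NUMBERS: `router/BOXES/La2CuO4-family.md` §OF-RECORD v1.11 (context row `U/t (E)` hi 14.7 → 14.8 = 5.0/0.34 outward) and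
§OF-RECORD v1.15 (run-7 §R-as fold v3.3: in-house direct-mode cRPA member 2.355 eV ⇒ `U/t (E)` lo 5.9 → 5.8); every other M13 row is
the v1.9 row (`t'/t ∈ [−3/10, −1/5]`, `n ∈ [0.99, 1.01]`, `t''/t = 0` for object E). THE M2(b) DOMAIN (lead g11 22:57:53Z «M2(b) BOX
NAMING»): «THE BOX for the M2(b) statement is OBJECT E of BOX OF RECORD #18 = M13 La₂CuO₄ @0: t′/t ∈ [−3/10, −1/5] · U/t ∈ [29/5, 74/5] ·
n = 1 EXACTLY in the certified statement (the S1 n-bar [0.99, 1.01] is screening context, not a domain)» — typed here as the one-coordinate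
re-issue `boxLa214E_M2b := boxLa214E_M13v115.withEntry filling [1, 1]`, a SUB-box of the S1 box (`boxLa214E_M2b_refines_M13v115`).

* §1 `la214E_v115_U = [29/5, 74/5]`; `boxLa214E_M13v115 := boxLa214E_M13v110.withEntry UOverT la214E_v115_U`; accessors; corners
  `la214E_M13v115_s2Lo/Hi = (29/5, −3/10, 99/100) / (74/5, −1/5, 101/100)`; `boxLa214E_M13v110_refines_v115` (v1.10 ⊆ v1.15: OUTWARD
  in `U`), `boxLa214E_M13v19_refines_v115`, `boxLa214E_M13_refines_v115`, downward transfer `holdsOn_boxLa214E_M13v110_of_v115`;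
  `boxLa214E_M13v115_energyWord`; `boxLa214E_M13v115_stiffnessWord_of_cellLeaf`; today's unconditional words
  `boxLa214E_M13v115_stiffness_kinematic` / `…_thermalStiffness_kinematic` (`0.4453763`, hubbard-tc p1's `U`-free half-bathtub leaf)
  and `boxLa214E_M13v115_Tc_le_kinematic_KT` (`0.3497978`).
* §2 THE M2(b) DOMAIN `boxLa214E_M2b` (n-entry `[1, 1]`): accessors, corners, `boxLa214E_M2b_refines_M13v115` (INWARD in `n`),
  `holdsOn_boxLa214E_M2b_of_M13v115`; **`boxLa214E_M2b_stiffnessWord_of_laBoxE_leaf`**: the La214-E leaf shape of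
  `Observables/StiffnessApexTransport*` — `∀ tp ∈ [−3/10, −1/5], ∀ U ∈ [29/5, 74/5], ObsStiffnessSeqCeilingAt tp U 1 c` — IS the stiffness
  word `HoldsOn (p ↦ ObsStiffnessSeqCeilingAt (p tp) (p U) (p n) c) boxLa214E_M2b`; hence THE ONE-`exact` CLOSERS of the box plan of
  record (obs RULING (fff) d302 / (ggg) d303, director R16–R17): `boxLa214E_M2b_stiffnessWord_of_apexStation29o5_orbitLower` (one station's
  family on `[−357/740, −1/5]`), `boxLa214E_M2b_stiffnessWord_of_apexStation29o5_two_chords` (the two boxdual bundles; `c ≥` the four chord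
  values), `boxLa214E_M2b_stiffnessWord_of_three_apexStations` (the three-station edition); `boxLa214E_M2b_stiffness_kinematic` (`0.4453763` today).

Everything here is PROVED (definitions with bodies; no `sorry`). HONEST FRAMING: S1's SYSTEMATIC box (screening grade) typed verbatim and
the lead-named certified-statement domain; typing certifies nothing about La₂CuO₄; every stiffness word is a one-sided CEILING conditional
on the leaf/families plugged in (CONTROL/CALIBRATION class at Mott points; a ceiling is silent on `ρ_s = 0`); no phase sentence; nothing
transfers UP from the v1.10 box to the new `U` strips `[5.8, 5.9)`, `(14.7, 14.8]`.
-/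

noncomputable section

namespace Summit.Ventures.CertifiedManyBodySolver.Downfold

open Set NonemptyInterval
open Summit.Ventures.CertifiedManyBodySolver.Observables
open Summit.Ventures.CertifiedManyBodySolver.Certificates
open Literature.MathematicalPhysics.QuantumLattice Literature.MathematicalPhysics.QuantumLattice.ThermodynamicLimit

/-! ## §1 `boxLa214E_M13v115` — La₂CuO₄ parent (x = 0), object E, column M13, P = 0 (§OF-RECORD v1.15) -/

/-- `U/t_eff ∈ [29/5, 74/5] = [5.8, 14.8]` (object E, column M13; §OF-RECORD v1.11: hi 14.7 → 14.8; v1.15: lo 5.9 → 5.8 — in-house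
direct-mode cRPA member 2.355 eV ÷ t_eff 0.40; was [5.9, 14.7] at v1.10). [folklore] -/
def la214E_v115_U : Entry := Entry.ofEnds (29/5) (74/5) (by norm_num) .screening

/-- **`boxLa214E_M13v115`** = `boxLa214E_M13v110` with `U/t_eff` re-issued as `la214E_v115_U` (v1.15); every other entry is the
v1.9/v1.10 entry. [folklore] -/
def boxLa214E_M13v115 : OneBandBox := boxLa214E_M13v110.withEntry .UOverT la214E_v115_U

/-- Accessor: the `U/t` entry of `boxLa214E_M13v115`. [folklore] -/
theorem boxLa214E_M13v115_U : boxLa214E_M13v115 .UOverT = some la214E_v115_U := Box.withEntry_self _ _ _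
/-- Accessor: the `tp/t` entry of `boxLa214E_M13v115` is the v1.9 entry `[−3/10, −1/5]`. [folklore] -/
theorem boxLa214E_M13v115_tp : boxLa214E_M13v115 .tpOverT = some la214E_M13v19_tp := by
  rw [boxLa214E_M13v115, Box.withEntry_of_ne _ _ (by decide)]; exact boxLa214E_M13v110_tp
/-- Accessor: the filling entry of `boxLa214E_M13v115` is the v1.9 entry `[99/100, 101/100]`. [folklore] -/
theorem boxLa214E_M13v115_n : boxLa214E_M13v115 .filling = some la214E_M13v19_n := by
  rw [boxLa214E_M13v115, Box.withEntry_of_ne _ _ (by decide)]; exact boxLa214E_M13v110_n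
/-- Accessor: the `tpp/t` entry of `boxLa214E_M13v115` is the v1.9 entry (`0`: object E). [folklore] -/
theorem boxLa214E_M13v115_tpp : boxLa214E_M13v115 .tppOverT = some la214E_M13v19_tpp := by
  rw [boxLa214E_M13v115, Box.withEntry_of_ne _ _ (by decide)]; exact boxLa214E_M13v110_tpp

/-- Lower corner of the delivered S2 box of `boxLa214E_M13v115`: `(29/5, −3/10, 99/100)`. [folklore] -/
theorem la214E_M13v115_s2Lo : s2Lo la214E_v115_U la214E_M13v19_tp la214E_M13v19_n = ![29/5, -3/10, 99/100] := by
  ext i; fin_cases i <;> simp [s2Lo, la214E_v115_U, la214E_M13v19_tp, la214E_M13v19_n]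

/-- Upper corner of the delivered S2 box of `boxLa214E_M13v115`: `(74/5, −1/5, 101/100)`. [folklore] -/
theorem la214E_M13v115_s2Hi : s2Hi la214E_v115_U la214E_M13v19_tp la214E_M13v19_n = ![74/5, -1/5, 101/100] := by
  ext i; fin_cases i <;> simp [s2Hi, la214E_v115_U, la214E_M13v19_tp, la214E_M13v19_n]

/-- **v1.10 ⊆ v1.15 at column M13 (object E)**: `U/t_eff` `[5.9, 14.7] ⊆ [5.8, 14.8]` (both edges OUTWARD). [folklore] -/
theorem boxLa214E_M13v110_refines_v115 : boxLa214E_M13v110.Refines boxLa214E_M13v115 :=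
  Box.refines_withEntry (e₀ := la214E_v110_U) boxLa214E_M13v110_U
    (fun _ hx => Entry.mem_ofEnds_mono (by norm_num) (by norm_num) hx)

/-- **v1.9 ⊆ v1.15** and **v1–v1.8 ⊆ v1.15** at column M13 (object E) (transitivity through v1.10). [folklore] -/
theorem boxLa214E_M13v19_refines_v115 : boxLa214E_M13v19.Refines boxLa214E_M13v115 :=
  boxLa214E_M13v19_refines_v110.trans boxLa214E_M13v110_refines_v115

/-- **v1–v1.8 ⊆ v1.15** at column M13 (object E). [folklore] -/
theorem boxLa214E_M13_refines_v115 : boxLa214E_M13.Refines boxLa214E_M13v115 :=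
  boxLa214E_M13_refines_v110.trans boxLa214E_M13v110_refines_v115

/-- **Downward transfer v1.15 → v1.10** at column M13 (object E); nothing transfers up to the new `U` strips. [folklore] -/
theorem holdsOn_boxLa214E_M13v110_of_v115 {W : (OneBandCoord → ℝ) → Prop} (h : HoldsOn W boxLa214E_M13v115) :
    HoldsOn W boxLa214E_M13v110 :=
  h.of_refines boxLa214E_M13v110_refines_v115

/-- Coordinates of a point of the delivered box `Set.Icc ![29/5, −3/10, 99/100] ![74/5, −1/5, 101/100]` (order `(U/t, t'/t, n)`). [folklore] -/
theorem mem_la214E_M13v115_s2Box {θ : Fin 3 → ℝ}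
    (hθ : θ ∈ Set.Icc (![29/5, -3/10, 99/100] : Fin 3 → ℝ) ![74/5, -1/5, 101/100]) :
    (29 / 5 ≤ θ 0 ∧ θ 0 ≤ 74 / 5) ∧ (-3 / 10 ≤ θ 1 ∧ θ 1 ≤ -1 / 5) ∧ (99 / 100 ≤ θ 2 ∧ θ 2 ≤ 101 / 100) := by
  rw [Set.mem_Icc, Pi.le_def, Pi.le_def] at hθ
  obtain ⟨hlo, hhi⟩ := hθ
  have h0 := hlo 0; have h1 := hlo 1; have h2 := hlo 2
  have h0' := hhi 0; have h1' := hhi 1; have h2' := hhi 2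
  simp only [Matrix.cons_val_zero, Matrix.cons_val_one, Matrix.head_cons, Matrix.cons_val_two,
    Matrix.tail_cons] at h0 h1 h2 h0' h1' h2'
  exact ⟨⟨h0, h0'⟩, ⟨h1, h1'⟩, ⟨h2, h2'⟩⟩

/-- **Energy word on `boxLa214E_M13v115` from ANY S2 statement of the `_word_Icc` shape on its delivered box**
`Set.Icc ![29/5, -3/10, 99/100] ![74/5, -1/5, 101/100]` (order `(U/t, tp/t, n)`). [folklore] -/
theorem boxLa214E_M13v115_energyWord {lo hi : ℝ}
    (hW : ∀ θ ∈ Set.Icc (![29/5, -3/10, 99/100] : Fin 3 → ℝ) ![74/5, -1/5, 101/100],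
      lo ≤ energyDensityTT' 1 (θ 1) (θ 0) (θ 2) ∧ energyDensityTT' 1 (θ 1) (θ 0) (θ 2) ≤ hi) :
    HoldsOn (fun p : OneBandCoord → ℝ =>
      lo ≤ energyDensityTT' 1 (p .tpOverT) (p .UOverT) (p .filling) ∧
        energyDensityTT' 1 (p .tpOverT) (p .UOverT) (p .filling) ≤ hi) boxLa214E_M13v115 := by
  have h := holdsOn_of_forall_s2Box (B := boxLa214E_M13v115) (eU := la214E_v115_U) (eS := la214E_M13v19_tp)
    (eN := la214E_M13v19_n) boxLa214E_M13v115_U boxLa214E_M13v115_tp boxLa214E_M13v115_n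
    (W := fun θ => lo ≤ energyDensityTT' 1 (θ 1) (θ 0) (θ 2) ∧ energyDensityTT' 1 (θ 1) (θ 0) (θ 2) ≤ hi)
    (by rw [la214E_M13v115_s2Lo, la214E_M13v115_s2Hi]; exact hW)
  exact h

/-- **Stiffness leaf on the v1.15 cell ⇒ the stiffness word on `boxLa214E_M13v115`** (S1 box: filling width `[0.99, 1.01]`).
[cite: ScalapinoWhiteZhang1993, §II] -/
theorem boxLa214E_M13v115_stiffnessWord_of_cellLeaf {c : ℚ}
    (hW : ∀ tp ∈ Set.Icc (-3 / 10 : ℝ) (-1 / 5), ∀ U ∈ Set.Icc (29 / 5 : ℝ) (74 / 5),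
      ∀ n ∈ Set.Icc (99 / 100 : ℝ) (101 / 100), ObsStiffnessSeqCeilingAt tp U n c) :
    HoldsOn (fun p : OneBandCoord → ℝ => ObsStiffnessSeqCeilingAt (p .tpOverT) (p .UOverT) (p .filling) c)
      boxLa214E_M13v115 := by
  refine holdsOn_of_forall_s2Box (B := boxLa214E_M13v115) (eU := la214E_v115_U) (eS := la214E_M13v19_tp)
    (eN := la214E_M13v19_n) boxLa214E_M13v115_U boxLa214E_M13v115_tp boxLa214E_M13v115_n
    (W := fun θ => ObsStiffnessSeqCeilingAt (θ 1) (θ 0) (θ 2) c) ?_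
  rw [la214E_M13v115_s2Lo, la214E_M13v115_s2Hi]
  intro θ hθ
  obtain ⟨hUθ, htθ, hnθ⟩ := mem_la214E_M13v115_s2Box hθ
  exact hW (θ 1) htθ (θ 0) hUθ (θ 2) hnθ

/-- **TODAY'S UNCONDITIONAL STIFFNESS WORD on `boxLa214E_M13v115`** (kinematic, node-free, `U`-free): `ρ_s ≤ 0.4453763` (tree units;
HVR `D_s ≤ 0.2226882`) at every point — hubbard-tc p1's `laBoxE_x0_stiffnessSeqLeaf`. [cite: HazraVermaRanderia2019, eqs. (2)-(6)] -/
theorem boxLa214E_M13v115_stiffness_kinematic :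
    HoldsOn (fun p : OneBandCoord → ℝ =>
      ObsStiffnessSeqCeilingAt (p .tpOverT) (p .UOverT) (p .filling) (4453763 / 10000000)) boxLa214E_M13v115 :=
  boxLa214E_M13v115_stiffnessWord_of_cellLeaf fun _tp htp _U _ n hn =>
    laBoxE_x0_stiffnessSeqLeaf htp (by linarith [hn.1]) hn.2

/-- **The thermal twin** (every temperature): `ObsThermalStiffnessSeqCeilingAt … 0.4453763` at every point of `boxLa214E_M13v115`.
[cite: ParamekantiTrivediRanderia1998, eq. (3) and §IV] -/
theorem boxLa214E_M13v115_thermalStiffness_kinematic :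
    HoldsOn (fun p : OneBandCoord → ℝ =>
      ObsThermalStiffnessSeqCeilingAt (p .tpOverT) (p .UOverT) (p .filling) (4453763 / 10000000)) boxLa214E_M13v115 := by
  refine holdsOn_of_forall_s2Box (B := boxLa214E_M13v115) (eU := la214E_v115_U) (eS := la214E_M13v19_tp)
    (eN := la214E_M13v19_n) boxLa214E_M13v115_U boxLa214E_M13v115_tp boxLa214E_M13v115_n
    (W := fun θ => ObsThermalStiffnessSeqCeilingAt (θ 1) (θ 0) (θ 2) (4453763 / 10000000)) ?_
  rw [la214E_M13v115_s2Lo, la214E_M13v115_s2Hi]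
  intro θ hθ
  obtain ⟨-, htθ, hnθ⟩ := mem_la214E_M13v115_s2Box hθ
  exact laBoxE_x0_thermalStiffnessSeqLeaf htθ (by linarith [hnθ.1]) hnθ.2

/-- **KT reading on `boxLa214E_M13v115`** (CONDITIONAL on the monotonicity-free KT dictionary at the point): `T_c ≤ 0.3497978` (tree units;
a ceiling on a transition temperature of the 2D single-layer MODEL, not a material `T_c`). [cite: HazraVermaRanderia2019, eqs. (2)-(3) and App. G] -/
theorem boxLa214E_M13v115_Tc_le_kinematic_KT :
    HoldsOn (fun p : OneBandCoord → ℝ => ∀ (ρe : ℝ → ℝ) (Tc : ℝ),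
      ThermalKTDictionaryAt (p .tpOverT) (p .UOverT) (p .filling) ρe Tc → Tc ≤ 0.3497978) boxLa214E_M13v115 := by
  refine holdsOn_of_forall_s2Box (B := boxLa214E_M13v115) (eU := la214E_v115_U) (eS := la214E_M13v19_tp)
    (eN := la214E_M13v19_n) boxLa214E_M13v115_U boxLa214E_M13v115_tp boxLa214E_M13v115_n
    (W := fun θ => ∀ (ρe : ℝ → ℝ) (Tc : ℝ), ThermalKTDictionaryAt (θ 1) (θ 0) (θ 2) ρe Tc → Tc ≤ 0.3497978) ?_
  rw [la214E_M13v115_s2Lo, la214E_M13v115_s2Hi]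
  intro θ hθ ρe Tc hKT
  obtain ⟨-, htθ, hnθ⟩ := mem_la214E_M13v115_s2Box hθ
  exact Summit.Ventures.CertifiedManyBodySolver.Certificates.ThermalKTDictionaryAt.laBoxE_x0_le_decimal htθ
    (by linarith [hnθ.1]) hnθ.2 hKT

/-! ## §2 THE M2(b) STATEMENT DOMAIN `boxLa214E_M2b` («La214-E»: `n = 1` EXACTLY) and its apex-transport closers -/

/-- The filling entry of the M2(b) certified statement: `n = 1` EXACTLY (lead g11, 2026-08-27T22:57:53Z: «the S1 n-bar [0.99, 1.01] is
screening context, not a domain»). [folklore] -/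
def la214E_M2b_n : Entry := Entry.ofEnds 1 1 le_rfl .screening

/-- **`boxLa214E_M2b`** («La214-E», the M2(b) statement domain) = `boxLa214E_M13v115` with the filling entry re-issued INWARD to `[1, 1]`:
`t'/t ∈ [−3/10, −1/5] × U/t ∈ [29/5, 74/5] × n = 1`. [folklore] -/
def boxLa214E_M2b : OneBandBox := boxLa214E_M13v115.withEntry .filling la214E_M2b_n

/-- Accessor: the filling entry of `boxLa214E_M2b` is `[1, 1]`. [folklore] -/
theorem boxLa214E_M2b_n : boxLa214E_M2b .filling = some la214E_M2b_n := Box.withEntry_self _ _ _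
/-- Accessor: the `U/t` entry of `boxLa214E_M2b` is `la214E_v115_U = [29/5, 74/5]`. [folklore] -/
theorem boxLa214E_M2b_U : boxLa214E_M2b .UOverT = some la214E_v115_U := by
  rw [boxLa214E_M2b, Box.withEntry_of_ne _ _ (by decide)]; exact boxLa214E_M13v115_U
/-- Accessor: the `tp/t` entry of `boxLa214E_M2b` is `[−3/10, −1/5]`. [folklore] -/
theorem boxLa214E_M2b_tp : boxLa214E_M2b .tpOverT = some la214E_M13v19_tp := by
  rw [boxLa214E_M2b, Box.withEntry_of_ne _ _ (by decide)]; exact boxLa214E_M13v115_tp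
/-- Accessor: the `tpp/t` entry of `boxLa214E_M2b` (`0`: object E). [folklore] -/
theorem boxLa214E_M2b_tpp : boxLa214E_M2b .tppOverT = some la214E_M13v19_tpp := by
  rw [boxLa214E_M2b, Box.withEntry_of_ne _ _ (by decide)]; exact boxLa214E_M13v115_tpp

/-- Corners of the delivered box of `boxLa214E_M2b`: `(29/5, −3/10, 1)` and `(74/5, −1/5, 1)`. [folklore] -/
theorem la214E_M2b_s2Lo : s2Lo la214E_v115_U la214E_M13v19_tp la214E_M2b_n = ![29/5, -3/10, 1] := by
  ext i; fin_cases i <;> simp [s2Lo, la214E_v115_U, la214E_M13v19_tp, la214E_M2b_n]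

/-- Upper corner of the delivered box of `boxLa214E_M2b`. [folklore] -/
theorem la214E_M2b_s2Hi : s2Hi la214E_v115_U la214E_M13v19_tp la214E_M2b_n = ![74/5, -1/5, 1] := by
  ext i; fin_cases i <;> simp [s2Hi, la214E_v115_U, la214E_M13v19_tp, la214E_M2b_n]

/-- **`boxLa214E_M2b ⊆ boxLa214E_M13v115`**: the statement domain is the `n = 1` slice of the S1 box (INWARD re-issue in `n`). [folklore] -/
theorem boxLa214E_M2b_refines_M13v115 : boxLa214E_M2b.Refines boxLa214E_M13v115 :=
  Box.withEntry_refines (e₀ := la214E_M13v19_n) boxLa214E_M13v115_n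
    (fun _ hx => Entry.mem_ofEnds_mono (by norm_num) (by norm_num) hx)

/-- **Every word on the S1 box holds on the M2(b) domain** (upward transfer through the inward re-issue). [folklore] -/
theorem holdsOn_boxLa214E_M2b_of_M13v115 {W : (OneBandCoord → ℝ) → Prop} (h : HoldsOn W boxLa214E_M13v115) :
    HoldsOn W boxLa214E_M2b :=
  h.of_refines boxLa214E_M2b_refines_M13v115

/-- Coordinates of a point of the delivered M2(b) box: `U ∈ [29/5, 74/5]`, `tp ∈ [−3/10, −1/5]`, `n = 1`. [folklore] -/
theorem mem_la214E_M2b_s2Box {θ : Fin 3 → ℝ}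
    (hθ : θ ∈ Set.Icc (![29/5, -3/10, 1] : Fin 3 → ℝ) ![74/5, -1/5, 1]) :
    θ 0 ∈ Set.Icc (29 / 5 : ℝ) (74 / 5) ∧ θ 1 ∈ Set.Icc (-3 / 10 : ℝ) (-1 / 5) ∧ θ 2 = 1 := by
  rw [Set.mem_Icc, Pi.le_def, Pi.le_def] at hθ
  obtain ⟨hlo, hhi⟩ := hθ
  have h0 := hlo 0; have h1 := hlo 1; have h2 := hlo 2
  have h0' := hhi 0; have h1' := hhi 1; have h2' := hhi 2
  simp only [Matrix.cons_val_zero, Matrix.cons_val_one, Matrix.head_cons, Matrix.cons_val_two,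
    Matrix.tail_cons] at h0 h1 h2 h0' h1' h2'
  exact ⟨⟨h0, h0'⟩, ⟨h1, h1'⟩, le_antisymm h2' h2⟩

/-- **THE M2(b) JOIN: the La214-E leaf IS the stiffness word on `boxLa214E_M2b`.** Any `c` with
`∀ tp ∈ [−3/10, −1/5], ∀ U ∈ [29/5, 74/5], ObsStiffnessSeqCeilingAt tp U 1 c` (the conclusion shape of every La214-E leaf of
`Observables/StiffnessApexTransport{,LaBoxE}` — one station, three stations, two chords) gives
`HoldsOn (p ↦ ObsStiffnessSeqCeilingAt (p tp) (p U) (p n) c) boxLa214E_M2b`. [cite: ScalapinoWhiteZhang1993, §II] -/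
theorem boxLa214E_M2b_stiffnessWord_of_laBoxE_leaf {c : ℚ}
    (hW : ∀ tp ∈ Set.Icc (-3 / 10 : ℝ) (-1 / 5), ∀ U ∈ Set.Icc (29 / 5 : ℝ) (74 / 5), ObsStiffnessSeqCeilingAt tp U 1 c) :
    HoldsOn (fun p : OneBandCoord → ℝ => ObsStiffnessSeqCeilingAt (p .tpOverT) (p .UOverT) (p .filling) c) boxLa214E_M2b := by
  refine holdsOn_of_forall_s2Box (B := boxLa214E_M2b) (eU := la214E_v115_U) (eS := la214E_M13v19_tp)
    (eN := la214E_M2b_n) boxLa214E_M2b_U boxLa214E_M2b_tp boxLa214E_M2b_n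
    (W := fun θ => ObsStiffnessSeqCeilingAt (θ 1) (θ 0) (θ 2) c) ?_
  rw [la214E_M2b_s2Lo, la214E_M2b_s2Hi]
  intro θ hθ
  obtain ⟨hUθ, htθ, hnθ⟩ := mem_la214E_M2b_s2Box hθ
  rw [hnθ]
  exact hW (θ 1) htθ (θ 0) hUθ

/-- **M2(b) CLOSER — ONE STATION.** An unconditional f-sum orbit-lower family `val` on the source segment `s ∈ [−357/740, −1/5]` at the station
`U_A = 29/5` (half filling) with `−val s ≤ c` there (`ObsStiffnessSeqCeilingAt_on_laBoxE_of_forall_apexStation29o5_orbitLower`) IS the stiffness word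
`c` on `boxLa214E_M2b`. [cite: KomaTasaki1994, §1] [cite: ScalapinoWhiteZhang1993, §II] -/
theorem boxLa214E_M2b_stiffnessWord_of_apexStation29o5_orbitLower (val : ℝ → ℝ) (c : ℚ)
    (h : ∀ s ∈ Set.Icc (-(357 / 740) : ℝ) (-1 / 5),
      ∀ (ω : InfVolFermionState 2) (Ls : ℕ → ℕ) (ψ : ∀ L, Fock (Orb (FermionTorus 2 L))),
      Filter.Tendsto Ls Filter.atTop Filter.atTop →
      (∀ j, IsGroundStateInSector (hubbardTorusTT' (Ls j) 1 s (29 / 5)) (rectN 1 (Ls j)) 0 (ψ (Ls j))) →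
      (∀ j, star (ψ (Ls j)) ⬝ᵥ ψ (Ls j) = 1) → ω.IsTorusLimitOf ψ Ls →
      val s ≤ ((Finset.univ : Finset (DihedralGroup 4)).card : ℝ)⁻¹ * ∑ g ∈ (Finset.univ : Finset (DihedralGroup 4)),
        (ω.expect (d4ShiftSet g 0 (Literature.Probability.LatticeModels.box 2 7))
          (fermionEmbed (PolySite.d4Emb g 0 (Literature.Probability.LatticeModels.box 2 7)) (-oddMomentObsTT s (29 / 5) 0))).re)
    (hc : ∀ s ∈ Set.Icc (-(357 / 740) : ℝ) (-1 / 5), -val s ≤ ((c : ℚ) : ℝ)) :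
    HoldsOn (fun p : OneBandCoord → ℝ => ObsStiffnessSeqCeilingAt (p .tpOverT) (p .UOverT) (p .filling) c) boxLa214E_M2b :=
  boxLa214E_M2b_stiffnessWord_of_laBoxE_leaf (ObsStiffnessSeqCeilingAt_on_laBoxE_of_forall_apexStation29o5_orbitLower val c h hc)

/-- **M2(b) CLOSER — THE TWO BOXDUAL BUNDLES (box plan of record, obs RULING (fff) d302 (fff2) / (ggg) d303).** The outer chord family on
`[−357/740, −3/10]` (vertex values `v₁, v₂`) and the inner chord family on `[−3/10, −1/5]` (`v₃, v₄`) at the station `29/5`, with `c ≥ −vᵢ`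
(`ObsStiffnessSeqCeilingAt_on_laBoxE_of_apexStation29o5_two_chords`), give the stiffness word `c` on `boxLa214E_M2b`. [cite: KomaTasaki1994, §1] [cite: ScalapinoWhiteZhang1993, §II] -/
theorem boxLa214E_M2b_stiffnessWord_of_apexStation29o5_two_chords (v₁ v₂ v₃ v₄ : ℝ) (c : ℚ)
    (hc₁ : -v₁ ≤ ((c : ℚ) : ℝ)) (hc₂ : -v₂ ≤ ((c : ℚ) : ℝ)) (hc₃ : -v₃ ≤ ((c : ℚ) : ℝ)) (hc₄ : -v₄ ≤ ((c : ℚ) : ℝ))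
    (hOuter : ∀ s ∈ Set.Icc (-(357 / 740) : ℝ) (-3 / 10),
      ∀ (ω : InfVolFermionState 2) (Ls : ℕ → ℕ) (ψ : ∀ L, Fock (Orb (FermionTorus 2 L))),
      Filter.Tendsto Ls Filter.atTop Filter.atTop →
      (∀ j, IsGroundStateInSector (hubbardTorusTT' (Ls j) 1 s (29 / 5)) (rectN 1 (Ls j)) 0 (ψ (Ls j))) →
      (∀ j, star (ψ (Ls j)) ⬝ᵥ ψ (Ls j) = 1) → ω.IsTorusLimitOf ψ Ls →
      (-3 / 10 - s) / (-3 / 10 - -(357 / 740)) * v₁ + (s - -(357 / 740)) / (-3 / 10 - -(357 / 740)) * v₂ ≤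
        ((Finset.univ : Finset (DihedralGroup 4)).card : ℝ)⁻¹ * ∑ g ∈ (Finset.univ : Finset (DihedralGroup 4)),
          (ω.expect (d4ShiftSet g 0 (Literature.Probability.LatticeModels.box 2 7))
            (fermionEmbed (PolySite.d4Emb g 0 (Literature.Probability.LatticeModels.box 2 7)) (-oddMomentObsTT s (29 / 5) 0))).re)
    (hInner : ∀ s ∈ Set.Icc (-3 / 10 : ℝ) (-1 / 5),
      ∀ (ω : InfVolFermionState 2) (Ls : ℕ → ℕ) (ψ : ∀ L, Fock (Orb (FermionTorus 2 L))),
      Filter.Tendsto Ls Filter.atTop Filter.atTop →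
      (∀ j, IsGroundStateInSector (hubbardTorusTT' (Ls j) 1 s (29 / 5)) (rectN 1 (Ls j)) 0 (ψ (Ls j))) →
      (∀ j, star (ψ (Ls j)) ⬝ᵥ ψ (Ls j) = 1) → ω.IsTorusLimitOf ψ Ls →
      (-1 / 5 - s) / (-1 / 5 - -3 / 10) * v₃ + (s - -3 / 10) / (-1 / 5 - -3 / 10) * v₄ ≤
        ((Finset.univ : Finset (DihedralGroup 4)).card : ℝ)⁻¹ * ∑ g ∈ (Finset.univ : Finset (DihedralGroup 4)),
          (ω.expect (d4ShiftSet g 0 (Literature.Probability.LatticeModels.box 2 7))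
            (fermionEmbed (PolySite.d4Emb g 0 (Literature.Probability.LatticeModels.box 2 7)) (-oddMomentObsTT s (29 / 5) 0))).re) :
    HoldsOn (fun p : OneBandCoord → ℝ => ObsStiffnessSeqCeilingAt (p .tpOverT) (p .UOverT) (p .filling) c) boxLa214E_M2b :=
  boxLa214E_M2b_stiffnessWord_of_laBoxE_leaf
    (ObsStiffnessSeqCeilingAt_on_laBoxE_of_apexStation29o5_two_chords v₁ v₂ v₃ v₄ c hc₁ hc₂ hc₃ hc₄ hOuter hInner)

/-- **M2(b) CLOSER — THREE STATIONS** `29/5, 8, 11` (the fallback edition of obs RULING (ggg) d303 (ggg2); overhang only to `≈ −0.383`):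
three unconditional f-sum orbit-lower families with `−valᵢ s ≤ c` on their source segments
(`ObsStiffnessSeqCeilingAt_on_laBoxE_of_three_apexStations_orbitLower`) give the stiffness word `c` on `boxLa214E_M2b`.
[cite: KomaTasaki1994, §1] [cite: ScalapinoWhiteZhang1993, §II] -/
theorem boxLa214E_M2b_stiffnessWord_of_three_apexStations (val₁ val₂ val₃ : ℝ → ℝ) (c : ℚ)
    (h₁ : ∀ s ∈ Set.Icc (-(153 / 400) : ℝ) (-1 / 5),
      ∀ (ω : InfVolFermionState 2) (Ls : ℕ → ℕ) (ψ : ∀ L, Fock (Orb (FermionTorus 2 L))),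
      Filter.Tendsto Ls Filter.atTop Filter.atTop →
      (∀ j, IsGroundStateInSector (hubbardTorusTT' (Ls j) 1 s (29 / 5)) (rectN 1 (Ls j)) 0 (ψ (Ls j))) →
      (∀ j, star (ψ (Ls j)) ⬝ᵥ ψ (Ls j) = 1) → ω.IsTorusLimitOf ψ Ls →
      val₁ s ≤ ((Finset.univ : Finset (DihedralGroup 4)).card : ℝ)⁻¹ * ∑ g ∈ (Finset.univ : Finset (DihedralGroup 4)),
        (ω.expect (d4ShiftSet g 0 (Literature.Probability.LatticeModels.box 2 7))
          (fermionEmbed (PolySite.d4Emb g 0 (Literature.Probability.LatticeModels.box 2 7)) (-oddMomentObsTT s (29 / 5) 0))).re)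
    (hc₁ : ∀ s ∈ Set.Icc (-(153 / 400) : ℝ) (-1 / 5), -val₁ s ≤ ((c : ℚ) : ℝ))
    (h₂ : ∀ s ∈ Set.Icc (-(21 / 55) : ℝ) (-1 / 5),
      ∀ (ω : InfVolFermionState 2) (Ls : ℕ → ℕ) (ψ : ∀ L, Fock (Orb (FermionTorus 2 L))),
      Filter.Tendsto Ls Filter.atTop Filter.atTop →
      (∀ j, IsGroundStateInSector (hubbardTorusTT' (Ls j) 1 s 8) (rectN 1 (Ls j)) 0 (ψ (Ls j))) →
      (∀ j, star (ψ (Ls j)) ⬝ᵥ ψ (Ls j) = 1) → ω.IsTorusLimitOf ψ Ls →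
      val₂ s ≤ ((Finset.univ : Finset (DihedralGroup 4)).card : ℝ)⁻¹ * ∑ g ∈ (Finset.univ : Finset (DihedralGroup 4)),
        (ω.expect (d4ShiftSet g 0 (Literature.Probability.LatticeModels.box 2 7))
          (fermionEmbed (PolySite.d4Emb g 0 (Literature.Probability.LatticeModels.box 2 7)) (-oddMomentObsTT s 8 0))).re)
    (hc₂ : ∀ s ∈ Set.Icc (-(21 / 55) : ℝ) (-1 / 5), -val₂ s ≤ ((c : ℚ) : ℝ))
    (h₃ : ∀ s ∈ Set.Icc (-(279 / 740) : ℝ) (-1 / 5),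
      ∀ (ω : InfVolFermionState 2) (Ls : ℕ → ℕ) (ψ : ∀ L, Fock (Orb (FermionTorus 2 L))),
      Filter.Tendsto Ls Filter.atTop Filter.atTop →
      (∀ j, IsGroundStateInSector (hubbardTorusTT' (Ls j) 1 s 11) (rectN 1 (Ls j)) 0 (ψ (Ls j))) →
      (∀ j, star (ψ (Ls j)) ⬝ᵥ ψ (Ls j) = 1) → ω.IsTorusLimitOf ψ Ls →
      val₃ s ≤ ((Finset.univ : Finset (DihedralGroup 4)).card : ℝ)⁻¹ * ∑ g ∈ (Finset.univ : Finset (DihedralGroup 4)),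
        (ω.expect (d4ShiftSet g 0 (Literature.Probability.LatticeModels.box 2 7))
          (fermionEmbed (PolySite.d4Emb g 0 (Literature.Probability.LatticeModels.box 2 7)) (-oddMomentObsTT s 11 0))).re)
    (hc₃ : ∀ s ∈ Set.Icc (-(279 / 740) : ℝ) (-1 / 5), -val₃ s ≤ ((c : ℚ) : ℝ)) :
    HoldsOn (fun p : OneBandCoord → ℝ => ObsStiffnessSeqCeilingAt (p .tpOverT) (p .UOverT) (p .filling) c) boxLa214E_M2b :=
  boxLa214E_M2b_stiffnessWord_of_laBoxE_leaf
    (ObsStiffnessSeqCeilingAt_on_laBoxE_of_three_apexStations_orbitLower val₁ val₂ val₃ c h₁ hc₁ h₂ hc₂ h₃ hc₃)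

/-- **TODAY'S UNCONDITIONAL STIFFNESS WORD on the M2(b) domain** (kinematic): `ρ_s ≤ 0.4453763` at every point of `boxLa214E_M2b`
(from the S1 box word by `boxLa214E_M2b_refines_M13v115`). [cite: HazraVermaRanderia2019, eqs. (2)-(6)] -/
theorem boxLa214E_M2b_stiffness_kinematic :
    HoldsOn (fun p : OneBandCoord → ℝ =>
      ObsStiffnessSeqCeilingAt (p .tpOverT) (p .UOverT) (p .filling) (4453763 / 10000000)) boxLa214E_M2b :=
  holdsOn_boxLa214E_M2b_of_M13v115 boxLa214E_M13v115_stiffness_kinematic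

/-! ## §3 (append, same seat) M2(b) CLOSER — FOUR STATIONS (the finer bottom ladder `29/5, 13/2, 8, 11`) -/

/-- **M2(b) CLOSER — FOUR STATIONS** `29/5, 13/2, 8, 11` (source segments `[−108/325, −1/5]`, `[−57/160, −1/5]`, `[−21/55, −1/5]`, `[−279/740, −1/5]`;
`ObsStiffnessSeqCeilingAt_on_laBoxE_of_four_apexStations_orbitLower`): four unconditional f-sum orbit-lower families with `−valᵢ s ≤ c` on their
segments give the stiffness word `c` on `boxLa214E_M2b`. The bottom station's overhang is only `−108/325 ≈ −0.332` (planning file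
`LA214E-STATION-LADDER.md`: required reduction below the local kinematic at `U = 29/5` is `2.1 %` instead of `13.3 %` for one station [float]).
[cite: KomaTasaki1994, §1] [cite: ScalapinoWhiteZhang1993, §II] -/
theorem boxLa214E_M2b_stiffnessWord_of_four_apexStations (val₁ val₂ val₃ val₄ : ℝ → ℝ) (c : ℚ)
    (h₁ : ∀ s ∈ Set.Icc (-(108 / 325) : ℝ) (-1 / 5),
      ∀ (ω : InfVolFermionState 2) (Ls : ℕ → ℕ) (ψ : ∀ L, Fock (Orb (FermionTorus 2 L))),
      Filter.Tendsto Ls Filter.atTop Filter.atTop →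
      (∀ j, IsGroundStateInSector (hubbardTorusTT' (Ls j) 1 s (29 / 5)) (rectN 1 (Ls j)) 0 (ψ (Ls j))) →
      (∀ j, star (ψ (Ls j)) ⬝ᵥ ψ (Ls j) = 1) → ω.IsTorusLimitOf ψ Ls →
      val₁ s ≤ ((Finset.univ : Finset (DihedralGroup 4)).card : ℝ)⁻¹ * ∑ g ∈ (Finset.univ : Finset (DihedralGroup 4)),
        (ω.expect (d4ShiftSet g 0 (Literature.Probability.LatticeModels.box 2 7))
          (fermionEmbed (PolySite.d4Emb g 0 (Literature.Probability.LatticeModels.box 2 7)) (-oddMomentObsTT s (29 / 5) 0))).re)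
    (hc₁ : ∀ s ∈ Set.Icc (-(108 / 325) : ℝ) (-1 / 5), -val₁ s ≤ ((c : ℚ) : ℝ))
    (h₂ : ∀ s ∈ Set.Icc (-(57 / 160) : ℝ) (-1 / 5),
      ∀ (ω : InfVolFermionState 2) (Ls : ℕ → ℕ) (ψ : ∀ L, Fock (Orb (FermionTorus 2 L))),
      Filter.Tendsto Ls Filter.atTop Filter.atTop →
      (∀ j, IsGroundStateInSector (hubbardTorusTT' (Ls j) 1 s (13 / 2)) (rectN 1 (Ls j)) 0 (ψ (Ls j))) →
      (∀ j, star (ψ (Ls j)) ⬝ᵥ ψ (Ls j) = 1) → ω.IsTorusLimitOf ψ Ls →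
      val₂ s ≤ ((Finset.univ : Finset (DihedralGroup 4)).card : ℝ)⁻¹ * ∑ g ∈ (Finset.univ : Finset (DihedralGroup 4)),
        (ω.expect (d4ShiftSet g 0 (Literature.Probability.LatticeModels.box 2 7))
          (fermionEmbed (PolySite.d4Emb g 0 (Literature.Probability.LatticeModels.box 2 7)) (-oddMomentObsTT s (13 / 2) 0))).re)
    (hc₂ : ∀ s ∈ Set.Icc (-(57 / 160) : ℝ) (-1 / 5), -val₂ s ≤ ((c : ℚ) : ℝ))
    (h₃ : ∀ s ∈ Set.Icc (-(21 / 55) : ℝ) (-1 / 5),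
      ∀ (ω : InfVolFermionState 2) (Ls : ℕ → ℕ) (ψ : ∀ L, Fock (Orb (FermionTorus 2 L))),
      Filter.Tendsto Ls Filter.atTop Filter.atTop →
      (∀ j, IsGroundStateInSector (hubbardTorusTT' (Ls j) 1 s 8) (rectN 1 (Ls j)) 0 (ψ (Ls j))) →
      (∀ j, star (ψ (Ls j)) ⬝ᵥ ψ (Ls j) = 1) → ω.IsTorusLimitOf ψ Ls →
      val₃ s ≤ ((Finset.univ : Finset (DihedralGroup 4)).card : ℝ)⁻¹ * ∑ g ∈ (Finset.univ : Finset (DihedralGroup 4)),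
        (ω.expect (d4ShiftSet g 0 (Literature.Probability.LatticeModels.box 2 7))
          (fermionEmbed (PolySite.d4Emb g 0 (Literature.Probability.LatticeModels.box 2 7)) (-oddMomentObsTT s 8 0))).re)
    (hc₃ : ∀ s ∈ Set.Icc (-(21 / 55) : ℝ) (-1 / 5), -val₃ s ≤ ((c : ℚ) : ℝ))
    (h₄ : ∀ s ∈ Set.Icc (-(279 / 740) : ℝ) (-1 / 5),
      ∀ (ω : InfVolFermionState 2) (Ls : ℕ → ℕ) (ψ : ∀ L, Fock (Orb (FermionTorus 2 L))),
      Filter.Tendsto Ls Filter.atTop Filter.atTop →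
      (∀ j, IsGroundStateInSector (hubbardTorusTT' (Ls j) 1 s 11) (rectN 1 (Ls j)) 0 (ψ (Ls j))) →
      (∀ j, star (ψ (Ls j)) ⬝ᵥ ψ (Ls j) = 1) → ω.IsTorusLimitOf ψ Ls →
      val₄ s ≤ ((Finset.univ : Finset (DihedralGroup 4)).card : ℝ)⁻¹ * ∑ g ∈ (Finset.univ : Finset (DihedralGroup 4)),
        (ω.expect (d4ShiftSet g 0 (Literature.Probability.LatticeModels.box 2 7))
          (fermionEmbed (PolySite.d4Emb g 0 (Literature.Probability.LatticeModels.box 2 7)) (-oddMomentObsTT s 11 0))).re)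
    (hc₄ : ∀ s ∈ Set.Icc (-(279 / 740) : ℝ) (-1 / 5), -val₄ s ≤ ((c : ℚ) : ℝ)) :
    HoldsOn (fun p : OneBandCoord → ℝ => ObsStiffnessSeqCeilingAt (p .tpOverT) (p .UOverT) (p .filling) c) boxLa214E_M2b :=
  boxLa214E_M2b_stiffnessWord_of_laBoxE_leaf
    (ObsStiffnessSeqCeilingAt_on_laBoxE_of_four_apexStations_orbitLower val₁ val₂ val₃ val₄ c h₁ hc₁ h₂ hc₂ h₃ hc₃ h₄ hc₄)

end Summit.Ventures.CertifiedManyBodySolver.Downfold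

end
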